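import Summits.QuantumFields.YangMills.Theorems.BalabanUVNodesN07Letters10OnA1NearTop
import Summits.QuantumFields.YangMills.Theorems.BalabanUVNodesN07FlatCurrentA1LineRowsAtRecordLam
import HarnessLib

/-!
# N07 (d′)-Lam, (R1) W5: n07-w4's near-top door (window over `Ω_{K−n−1}`), criticality in CELL FORM (S4-Lam, fifth and last wrapper)

WHY (n07-e memo `LOCATED-DPRIME-CALIBRATION` §4 (R1), `DPRIME-LAM-ROADMAP` §2).  The (d′) letters `hA1` of the N07 head token (MODULE 100 :110–176) are read at MEETING datums,
whose window lies over `Ω′_{K−n−1}` of the meet family — n07-w4's `_nearTop` edition of S4.  Like S4 it asks `IsCritOnFibre F N K 𝔹 …` for a determining set; the record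
supplies only print's cell-form criticality ([15] (156)–(157); n07-e MODULES 101–104).  This file is the near-top door over the cell-form chain W1–W3b (n07-e MODULES 109–112).

WHAT IS PROVED (sorry-free; no definition; axioms standard): ★★★★ `exists_letters10On_A1_of_flatSocket_T4_nearTop_lam` — n07-w4's statement VERBATIM with the binders
`(𝔹) (_ : bondsOf 𝔹 ⊆ LamBonds ≤ K − n) (U₁) (reading) (_ : IsCritOnFibre …)` replaced by `(U₁) (reading) (_ : cell-form criticality)`; proof VERBATIM over W3b-Lam.
HONEST FRAMING: a re-cut of one wrapper, no new analysis; NOTHING of [15]'s estimates asserted beyond the cited files; (d′) ∕ `HThm4RecDbar` ∕ budget row of MODULE 100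
untouched — supplier side only; K0⁷ NOT closed; N07 NOT discharged; counts unmoved; one finite 𝕋⁴ programme at fixed ε — NOT continuum ∕ ℝ⁴ ∕ OS ∕ mass gap ∕ Clay.
No `sorry`, no `def`, no `instance`, no `notation`.

References: [15] = Balaban1985Variational (27) p.282, (44)–(50) p.285, (55) p.286, (127)–(128) p.297, (144) p.300, (150)–(153) p.301, (156)–(159) pp.302–303; Balaban1985Averaging
(92) p.31, Prop. 4 (134)–(135) p.38; Balaban1984PropagatorsII (2.1)–(2.3) p.224, (2.35) p.228; Balaban1988Convergent (2.10)–(2.12) p.256.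
-/

set_option autoImplicit false

noncomputable section

open scoped BigOperators Matrix Matrix.Norms.L2Operator InnerProductSpace RealInnerProductSpace ContDiff

namespace Summit.QuantumFields.YangMills.BalabanUVNodes.N07Letters10OnA1NearTopLam

open Literature.MathematicalPhysics.QuantumFieldTheory.Balaban1983to89
open Literature.MathematicalPhysics.QuantumFieldTheory.Balaban1983to89.Node00
open Literature.MathematicalPhysics.QuantumFieldTheory.BalabanImbrieJaffe1984to88.BIJ85AxialPropagator411 (BondSpace)
open Literature.MathematicalPhysics.QuantumFieldTheory.BalabanImbrieJaffe1984to88.BIJ85Sigma422Eta (eta_inv eta_pos)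
open T4Continuum (T4Family)
open T4AdjointCovarianceUnitary (lieSU mem_lieSU_iff)
open B9AdOrthogonal (herm0)
open B15DeterminingSets (bondsOf DetSet avgFamily)
open B6SectADomainsV1 (Domains)
open B6SectAOperatorsV1 (BondIdx BondIdxSpace QE QsE RE dsE dcE dcsE)
open B6SectAVectorModelV1 (deltaAE GE EE)
open B6SectA (hOp)
open Summit.QuantumFields.YangMills.Theorems.FlatCubeOpsText (Adm22)
open Summit.QuantumFields.YangMills.Theorems.K0FlatCubeOpsTextP (IsLevWeight flatH IsFlatGW GtSupLetterG BodyAt levWeight_nonneg)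
open Summit.QuantumFields.YangMills.Theorems.K0FlatPortBodyP (body_of_adm22_T4)
open Summit.QuantumFields.YangMills.Theorems.Prop8Chart (expCfg)
open Summit.QuantumFields.YangMills.Theorems.Prop8ChartDoubleBar (chartLogFlat)
open Summit.QuantumFields.YangMills.Theorems.K0Stub1MultiplierLetterP (B₀_nonneg_of_hSupLetterG)
open Summit.QuantumFields.YangMills.Theorems.K0Stub1MultiplierLetterAtRecord (gRowsBand_of_adm22_T4)
open Summit.QuantumFields.YangMills.Theorems.K0Stub1Letter165GtLetterAtRecord (letter165_rows_of_critical128_bodyAt)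
open Summit.QuantumFields.YangMills.Theorems.K0Stub1H128OfFlatSocket (h128_of_socket127_flat re_trace_pairing_rescaled_current_traceless inv_I_eta_smul_mem_herm0)
open Summit.QuantumFields.YangMills.Theorems.K0Stub1FlatCurrentA1LineRows (norm_inv_I_eta_smul)
open Summit.QuantumFields.YangMills.BalabanUVNodes.N07FlatCurrentA1LineRowsAtRecordLam (exists_sectF_W_flatScaled_atRecord_socket_A1rows_lam)
open Summit.QuantumFields.YangMills.Theorems.K0Stub1Letters10OnA1OfFlatSocket (hermLetter_rows_lt)
open Summit.QuantumFields.YangMills.BalabanUVNodes.N07HalvingStepTopOfLocalLetters (Letters10On)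
open Summit.QuantumFields.YangMills.BalabanUVNodes.N07Letters10OfRealRows (letters10On_of_realRows)
open Summit.QuantumFields.YangMills.BalabanUVNodes.N07Letters10OfWeightedRowsNearTop (pow_inv_le_levWeightP_of_inOm)
open Summit.QuantumFields.YangMills.BalabanUVNodes.N07MultiplierLetterNearTop (multiplierLetter_matrix_of_bodyAt_adm22_nearTop curlCurl_row_of_critical128_mat_lb)

variable {N : ℕ} [NeZero N]
open Summit.QuantumFields.YangMills.BalabanUVNodes.N07Letters10OnA1NearTop (exists_letters10On_A1_closed_of_adm22_T4_nearTop)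

/-- ★★★★ **n07-w4's NEAR-TOP DOOR — CELL-FORM (Lam) EDITION** of `N07Letters10OnA1NearTop.exists_letters10On_A1_of_flatSocket_T4_nearTop` (S4 with the window over
`Ω_{K−n−1}` of the meet family, `hY : ∀ x ∈ Y, D.InOm (K − n − 1) x`): the SAME statement EXCEPT that the criticality of `U₁` is asked in the CORE's cell form (stationarity of `𝔄`
along differentiable `SU(N)` curves through `U₁` keeping the averages on the (2.3) CELLS `D.LamBond j c`, `j ≤ K − n`) instead of `IsCritOnFibre F N K 𝔹 …` for a determining set.
Proof = n07-w4's VERBATIM (`exists_letters10On_A1_closed_of_adm22_T4_nearTop`, k0-s1 `h128_of_socket127_flat`, `hermLetter_rows_lt` cited by name) over n07-e W3b-Lam.  THIS is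
the supplier the assembly of (d′)-Lam (`hA1` of MODULE 100 with :120 in cell form) calls at a MEETING datum, the window supplied by n07-e 57a ∕
`N07SplitClauseHeadAtMeetCube.inOm_pred_meet_of_mem_box`.
[cite: Balaban1985Variational, (27) p.282, (44)-(50) p.285, (55) p.286, (127)-(128) p.297, (144) p.300, (150) p.301, (152)-(153) p.301, (156)-(159) pp.302-303; Balaban1985Averaging, (92) p.31, Prop. 4 (134)-(135) p.38; Balaban1984PropagatorsII, (2.1)-(2.3) p.224, (2.35) p.228; Balaban1988Convergent, (2.10)-(2.12) p.256] -/
theorem exists_letters10On_A1_of_flatSocket_T4_nearTop_lam (F : T4Family) :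
    ∃ (Mh₀ R₀ : ℕ) (B₀ δ₀ B₃ CG ε C₄ : ℝ), 0 < δ₀ ∧ 0 < B₃ ∧ 0 ≤ CG ∧ 0 < ε ∧ 0 ≤ C₄ ∧
    ∀ (n K : ℕ) (_ : 1 ≤ K - n) (_ : K - n + 1 ≤ F.m + K) {Mh R a' : ℕ} (_ : Mh = F.L ^ a') (_ : Mh₀ ≤ Mh) (_ : R₀ ≤ R)
      (_ : a' + 3 ≤ F.m + n) (D : Domains (F.P K)) (_ : D.k = K - n) (_ : Adm22 D R (F.L * Mh))
      (w : ℕ → PBond (F.P K) 0 → ℝ) (_ : IsLevWeight (F.P K) (K - n) D w),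
    -- Sect. F's ♭ chart at this family, RE-EXPORTED with its defining rows
    ∃ (H : (BondIdx D → Matrix (Fin N) (Fin N) ℂ) →ₗ[ℂ] (PBond (F.P K) 0 → Matrix (Fin N) (Fin N) ℂ))
      (Dsel : (PBond (F.P K) 0 → Matrix (Fin N) (Fin N) ℂ) → (BondIdx D → Matrix (Fin N) (Fin N) ℂ)),
      (∀ (X : BondIdx D → Matrix (Fin N) (Fin N) ℂ) (b : PBond (F.P K) 0), H X b =
        ∑ t, (((((F.P K).L : ℝ) ^ (t.1.1 : ℕ) * ((((F.P K).L : ℝ))⁻¹) ^ (K - n))⁻¹ * flatH (F.P K) (K - n) D (Pi.single t 1) b : ℝ) : ℂ) • X t) ∧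
      (∀ A' : PBond (F.P K) 0 → Matrix (Fin N) (Fin N) ℂ, (∀ b, w 1 b * ‖A' b‖ < ε) →
        ∀ ρ' : ℝ, 0 ≤ ρ' → (∀ b, w 1 b * ‖A' b‖ ≤ ρ') → ∀ i : BondIdx D, ‖Dsel A' i‖ ≤ C₄ * ρ' ^ 2) ∧
      ContDiffOn ℂ ω Dsel {Y : PBond (F.P K) 0 → Matrix (Fin N) (Fin N) ℂ | ∀ b, w 1 b * ‖Y b‖ < ε} ∧
      (∀ A' : PBond (F.P K) 0 → Matrix (Fin N) (Fin N) ℂ, (∀ b, w 1 b * ‖A' b‖ < ε) →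
        chartLogFlat (((((F.P K).L : ℝ))⁻¹) ^ (K - n)) D (A' - H (Dsel A')) - (fderiv ℂ (chartLogFlat (((((F.P K).L : ℝ))⁻¹) ^ (K - n)) D :
        (PBond (F.P K) 0 → Matrix (Fin N) (Fin N) ℂ) → BondIdx D → Matrix (Fin N) (Fin N) ℂ) 0) (A' - H (Dsel A')) = Dsel A' ∧
        chartLogFlat (((((F.P K).L : ℝ))⁻¹) ^ (K - n)) D (A' - H (Dsel A')) = (fderiv ℂ (chartLogFlat (((((F.P K).L : ℝ))⁻¹) ^ (K - n)) D :
        (PBond (F.P K) 0 → Matrix (Fin N) (Fin N) ℂ) → BondIdx D → Matrix (Fin N) (Fin N) ℂ) 0) A') ∧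
      (∀ A' : PBond (F.P K) 0 → Matrix (Fin N) (Fin N) ℂ, (∀ b, w 1 b * ‖A' b‖ < ε) → (∀ b, A' b ∈ herm0 (Fin N)) →
        (∀ i, Dsel A' i ∈ herm0 (Fin N)) ∧ ∀ b, (A' - H (Dsel A')) b ∈ herm0 (Fin N)) ∧
      -- THE A₁ LINE: p595460's kernel-formula letters; then every small 𝔰𝔲(N)-valued `X` on the slice whose charted point is critical on the record's fibre
      ∀ {instDE : DecidableEq (PBond (F.P K) 0)} {instDB : DecidableEq (BondIdx D)}
    {DV GV MV : (PBond (F.P K) 0 → Matrix (Fin N) (Fin N) ℂ) →ₗ[ℂ] (PBond (F.P K) 0 → Matrix (Fin N) (Fin N) ℂ)}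
    {QV : (PBond (F.P K) 0 → Matrix (Fin N) (Fin N) ℂ) →ₗ[ℂ] (BondIdx D → Matrix (Fin N) (Fin N) ℂ)}
    {HV : (BondIdx D → Matrix (Fin N) (Fin N) ℂ) →ₗ[ℂ] (PBond (F.P K) 0 → Matrix (Fin N) (Fin N) ℂ)}
    (_ : ∀ (A : PBond (F.P K) 0 → Matrix (Fin N) (Fin N) ℂ) (b : PBond (F.P K) 0),
      DV A b = ∑ j, ((WithLp.ofLp (deltaAE D ((F.P K).L ^ (K - n) : ℝ) (fun _ => (1 : ℝ)) (WithLp.toLp 2 (Pi.single j 1))) b : ℝ) : ℂ) • A j)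
    (_ : ∀ (A : PBond (F.P K) 0 → Matrix (Fin N) (Fin N) ℂ) (b : PBond (F.P K) 0),
      GV A b = ∑ j, ((WithLp.ofLp ((GE D (c := ((F.P K).L : ℝ) ^ (K - n)) (pow_ne_zero _ (Nat.cast_ne_zero.2 (F.P K).L_pos.ne')) (w := fun _ => (1 : ℝ)) (fun _ => one_pos)
        - hOp (GE D (c := ((F.P K).L : ℝ) ^ (K - n)) (pow_ne_zero _ (Nat.cast_ne_zero.2 (F.P K).L_pos.ne')) (w := fun _ => (1 : ℝ)) (fun _ => one_pos)) (QsE D)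
            (EE D (c := ((F.P K).L : ℝ) ^ (K - n)) (pow_ne_zero _ (Nat.cast_ne_zero.2 (F.P K).L_pos.ne')) (w := fun _ => (1 : ℝ)) (fun _ => one_pos))
          ∘ₗ QE D ∘ₗ GE D (c := ((F.P K).L : ℝ) ^ (K - n)) (pow_ne_zero _ (Nat.cast_ne_zero.2 (F.P K).L_pos.ne')) (w := fun _ => (1 : ℝ)) (fun _ => one_pos))
        (WithLp.toLp 2 (Pi.single j 1))) b : ℝ) : ℂ) • A j)
    (_ : ∀ (A : PBond (F.P K) 0 → Matrix (Fin N) (Fin N) ℂ) (t : BondIdx D),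
      QV A t = ∑ j, ((WithLp.ofLp (QE D (WithLp.toLp 2 (Pi.single j 1))) t : ℝ) : ℂ) • A j)
    (_ : ∀ (B : BondIdx D → Matrix (Fin N) (Fin N) ℂ) (b : PBond (F.P K) 0),
      HV B b = ∑ t, ((WithLp.ofLp (hOp (GE D (c := ((F.P K).L : ℝ) ^ (K - n)) (pow_ne_zero _ (Nat.cast_ne_zero.2 (F.P K).L_pos.ne')) (w := fun _ => (1 : ℝ)) (fun _ => one_pos))
        (QsE D) (EE D (c := ((F.P K).L : ℝ) ^ (K - n)) (pow_ne_zero _ (Nat.cast_ne_zero.2 (F.P K).L_pos.ne')) (w := fun _ => (1 : ℝ)) (fun _ => one_pos))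
        (WithLp.toLp 2 (Pi.single t 1))) b : ℝ) : ℂ) • B t)
    (_ : ∀ (A : PBond (F.P K) 0 → Matrix (Fin N) (Fin N) ℂ) (b : PBond (F.P K) 0),
      MV A b = ∑ j, ((WithLp.ofLp ((QsE D
          ∘ₗ EE D (c := ((F.P K).L : ℝ) ^ (K - n)) (pow_ne_zero _ (Nat.cast_ne_zero.2 (F.P K).L_pos.ne')) (w := fun _ => (1 : ℝ)) (fun _ => one_pos)
          ∘ₗ QE D ∘ₗ GE D (c := ((F.P K).L : ℝ) ^ (K - n)) (pow_ne_zero _ (Nat.cast_ne_zero.2 (F.P K).L_pos.ne')) (w := fun _ => (1 : ℝ)) (fun _ => one_pos))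
        (WithLp.toLp 2 (Pi.single j 1))) b : ℝ) : ℂ) • A j)
        (X : PBond (F.P K) 0 → lieSU (Fin N)) (ρ' : ℝ) (_ : ρ' < ((((F.P K).L : ℝ)⁻¹) ^ (K - n)) * ε)
        (_ : ∀ b, w 1 b * ‖((X b : lieSU (Fin N)) : Matrix (Fin N) (Fin N) ℂ)‖ ≤ ρ')
        (_ : ∀ (b : PBond (F.P K) 0) (ν : Fin 4),
          w 2 b * (F.L : ℝ) ^ (K - n) * ‖((X ⟨b.src.shift ν, b.dir⟩ : lieSU (Fin N)) : Matrix (Fin N) (Fin N) ℂ) - ((X b : lieSU (Fin N)) : Matrix (Fin N) (Fin N) ℂ)‖ ≤ ρ')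
        (_ : ∀ φ : Matrix (Fin N) (Fin N) ℂ →L[ℂ] ℂ,
          RE D (((F.P K).L : ℝ) ^ (K - n)) (dsE (((F.P K).L : ℝ) ^ (K - n)) (WithLp.toLp 2 (fun b => (φ ((X b : lieSU (Fin N)) : Matrix (Fin N) (Fin N) ℂ)).re))) = 0)
        (U₁ : GaugeField (F.P K) 0 (SU N))
        (_ : ∀ b, ((U₁ b : SU N) : Matrix (Fin N) (Fin N) ℂ) =
          ((expCfg ((((F.P K).L : ℝ)⁻¹) ^ (K - n))
            ((fun b => (Complex.I * (((((F.P K).L : ℝ)⁻¹) ^ (K - n) : ℝ) : ℂ))⁻¹ • ((X b : lieSU (Fin N)) : Matrix (Fin N) (Fin N) ℂ)) -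
              H (Dsel (fun b => (Complex.I * (((((F.P K).L : ℝ)⁻¹) ^ (K - n) : ℝ) : ℂ))⁻¹ • ((X b : lieSU (Fin N)) : Matrix (Fin N) (Fin N) ℂ)))) b :
            (Matrix (Fin N) (Fin N) ℂ)ˣ) : _))
        -- the criticality of the charted configuration, CELL FORM (print's (ii)-reading of [15] (156)–(157); no determining set)
        (_ : ∀ γ : ℝ → GaugeField (F.P K) 0 (SU N), γ 0 = U₁ →
          DifferentiableAt ℝ (fun (t : ℝ) (b : PBond (F.P K) 0) => ((γ t b : SU N) : Matrix (Fin N) (Fin N) ℂ)) 0 →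
          (∀ (t : ℝ) (j : ℕ) (c : PBond (F.P K) j), j ≤ K - n → D.LamBond j c →
            avgFamily (avOfRecord F N K) (γ t) j c = avgFamily (avOfRecord F N K) U₁ j c) →
          HasDerivAt (fun t => wilsonAction4 (γ t)) 0 0)
        {Y : Set (Site (F.P K) 0)} (_ : ∀ x ∈ Y, D.InOm (K - n - 1) x) {t : ℝ}
        (_ : (F.L : ℝ) ^ 8 * (max B₀ (1 + (B₀ * B₃ + 1) * (F.L : ℝ) * CG) *
          ((2 * (((F.P K).L ^ (K - n) : ℝ) ^ 2 * ((((F.P K).L : ℝ)⁻¹) ^ (K - n)) ^ (F.P K).d * ((((F.P K).L : ℝ)⁻¹) ^ (K - n))⁻¹) *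
            ((((F.P K).L : ℝ)⁻¹) ^ (K - n))⁻¹ ^ 2 * C₄) * ρ' ^ 2) ) < t),
        Letters10On Y ((F.P K).eta (K - n)) t
          ((fun b => ((X b : lieSU (Fin N)) : Matrix (Fin N) (Fin N) ℂ)) - HV (QV fun b => ((X b : lieSU (Fin N)) : Matrix (Fin N) (Fin N) ℂ))) := by
  obtain ⟨Mh₀, R₀, B₀, δ₀, B₃, CG, hδ₀, hB₃, hCG, hA1⟩ := exists_letters10On_A1_closed_of_adm22_T4_nearTop (N := N) F
  obtain ⟨Mh₀', R₀', ε, C₄, hε, hC₄, hS⟩ := exists_sectF_W_flatScaled_atRecord_socket_A1rows_lam N F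
  refine ⟨max Mh₀ Mh₀', max R₀ R₀', B₀, δ₀, B₃, CG, ε, C₄, hδ₀, hB₃, hCG, hε, hC₄, ?_⟩
  intro n K h1K hKm Mh R a' hMha hMh₀ hR₀ ha' D hDk hAdm w hw
  obtain ⟨τ, ρ, BE, B, hc, hwa, MVf, H, Dsel, Qt, Ht, Dt, e, WS, hntr, hρ, hBE, hB, hMVf, hH, h55, hcd, hfix, hherm, hQt, hHt, hDt, he, h157, hdiff, h158,
    hsock, hWq, hWAtr⟩ := hS n K h1K hKm hMha (le_trans (le_max_right _ _) hMh₀) (le_trans (le_max_right _ _) hR₀) ha' D hDk hAdm hw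
  refine ⟨H, Dsel, hH, h55, hcd, hfix, hherm, ?_⟩
  intro instDE instDB DV GV MV QV HV hDV hGV hQV hHV hMV X ρ' hρ' hX1 hX2 hslice U₁ hU₁ hcrit Y hY t ht
  -- abbreviations
  set η : ℝ := (((F.P K).L : ℝ)⁻¹) ^ (K - n) with hηdef
  set c : ℝ := ((F.P K).L ^ (K - n) : ℝ) with hcdef
  have hL0 : (0 : ℝ) < (F.P K).L := Nat.cast_pos.2 (F.P K).L_pos
  have hη0 : 0 < η := by rw [hηdef]; positivity
  have hηne : η ≠ 0 := hη0.ne'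
  have hcne : c ≠ 0 := by rw [hcdef]; positivity
  -- the Hermitian letter `A′₁ := (iη)⁻¹•⇑X`: herm0, in the two-size window
  set A₁ : PBond (F.P K) 0 → Matrix (Fin N) (Fin N) ℂ := fun b => (Complex.I * (η : ℂ))⁻¹ • ((X b : lieSU (Fin N)) : Matrix (Fin N) (Fin N) ℂ) with hA₁def
  have hA₁h : ∀ b, A₁ b ∈ herm0 (Fin N) := fun b => inv_I_eta_smul_mem_herm0 (X b).2
  obtain ⟨hA₁1, hA₁2⟩ := hermLetter_rows_lt (P := F.P K) (Λ := (F.L : ℝ) ^ (K - n)) hη0 w X hρ' hX1 hX2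
  -- the tangent letter `X₁ := X` in S1's carrier
  let X₁ : TangentBondSU (F.P K) 0 N := WithLp.toLp 2 X
  have hX₁ : ∀ b, ((X₁ b : lieSU (Fin N)) : Matrix (Fin N) (Fin N) ℂ) = (Complex.I * (η : ℂ)) • A₁ b := by
    intro b
    show ((X b : lieSU (Fin N)) : Matrix (Fin N) (Fin N) ℂ) = (Complex.I * (η : ℂ)) • ((Complex.I * (η : ℂ))⁻¹ • ((X b : lieSU (Fin N)) : Matrix (Fin N) (Fin N) ℂ))
    rw [smul_smul, mul_inv_cancel₀ (mul_ne_zero Complex.I_ne_zero (Complex.ofReal_ne_zero.2 hηne)), one_smul]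
  -- the fourth row `h128` from the socket (p643165), for the current `W_A₁ ⇑X = κ•(W_S A′₁)♮`
  have h128 := h128_of_socket127_flat (N := N) D hηne hcne (fun _ => (1 : ℝ)) hDV hQV X₁ hslice (BE (WS A₁))
    (fun j => (Complex.I * (c : ℂ) ^ 2 * (η : ℂ) ^ (F.P K).d * ((η : ℂ))⁻¹) • (WS A₁ j - (((N : ℂ))⁻¹ * (WS A₁ j).trace) • (1 : Matrix (Fin N) (Fin N) ℂ)))
    (re_trace_pairing_rescaled_current_traceless η c hηne τ hntr BE hBE (WS A₁))
    (fun δ δX hδh hδQ hδX => hsock A₁ δ hA₁1 hA₁2 hA₁h hδh hδQ U₁ hU₁ hcrit X₁ δX hX₁ hδX)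
  -- the A₁ line (p612312) with its four `W`-rows discharged
  exact hA1 n K h1K hKm hMha (le_trans (le_max_left _ _) hMh₀) (le_trans (le_max_left _ _) hR₀) ha' D hDk hAdm w hw hDV hGV hQV hHV hMV
    (fun Y b => (Complex.I * (c : ℂ) ^ 2 * (η : ℂ) ^ (F.P K).d * ((η : ℂ))⁻¹) •
      (WS (fun b' => (Complex.I * (η : ℂ))⁻¹ • Y b') b - (((N : ℂ))⁻¹ * (WS (fun b' => (Complex.I * (η : ℂ))⁻¹ • Y b') b).trace) • (1 : Matrix (Fin N) (Fin N) ℂ)))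
    hWq X (hWAtr X ρ' hρ' hX1 hX2).1 (hWAtr X ρ' hρ' hX1 hX2).2 h128 hρ' hX1 hX2 hslice hY ht

end Summit.QuantumFields.YangMills.BalabanUVNodes.N07Letters10OnA1NearTopLam

end
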